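import Literature.MathematicalPhysics.QuantumFieldTheory.Balaban1983to89.B9Eq315QTowerFlat
import Literature.MathematicalPhysics.QuantumFieldTheory.Balaban1983to89.B5Eq172FlatCoercivity

/-!
# `Balaban1983to89.B9Eq326OperatorTowerFlat` — T. Bałaban, *Propagators for lattice gauge theories in a background field*, Commun. Math. Phys.
# **99** (1985) 389–434 [Balaban1985BackgroundPropagators] (3.26) p. 395 with (3.15)/(3.19) p. 393 AT `k = n+1` LEVELS AND THE FLAT BACKGROUND:
# THE HODGE PACKAGE OF THE `k`-LEVEL OPERATOR `Δ_a(1) = Δ(1) + D R(1) D* + Q_k(1)* a Q_k(1)` — [B5] (1.55) `Q_k ∂ = ∂₁ Q′_k` and p. 27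
# «Q_k A₀ = B₀» ALONG THE TOWER, and [B5] p. 30 «the positivity of Δ_a follows»: the displayed positivity `hpos` of
# `B9Eq326OperatorTower.G1k ∕ H1k ∕ frakGk` IS A THEOREM at `U ≡ 1`, at every number of levels

statement-level skeleton of published theorems with citation tags; proofs where landed; nothing here is a claim about the Yang–Mills mass gap

CITATION HEADER (lean-in-tree rule).  Audit cell `pub-balaban`, sub-cell `t4`, BINDER row NE9; filed by the row OWNER lineage `b2b-balaban-t4-ne9-p1`
(gen 83) executing its own OFFER O-ne9p1-g79-2 («the MULTI-LEVEL flat package (T1)–(T4) for E167 `B9Eq326OperatorTower.laplaceAk` at U ≡ 1, whose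
`hpos` is displayed exactly like E162's was»).  Sources READ by this lineage in the held texts: [Balaban1985BackgroundPropagators] pp. 393–395, 416
(`paper:balaban1985-cmp99-background-propagators`, journal page = PDF page + 388); T. Bałaban, *Propagators and renormalization transformations for
lattice gauge theories. I*, Commun. Math. Phys. **95** (1984) 17–40 [Balaban1984PropagatorsI] pp. 22, 27, 30 (`paper:balaban1984-cmp95-propagators-rt-i`);
T. Bałaban, *Averaging operations for lattice gauge theories*, Commun. Math. Phys. **98** (1985) 17–51 [Balaban1985Averaging] pp. 36–37.

THE PRINT (verbatim).  [Balaban1985BackgroundPropagators] (3.15) p. 393: *«Q_j(U) = Q(Ū^{j−1})…Q(Ū)Q(U)»*; (3.19) p. 393 (the composite `Q′_j(U)`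
of the one-step site averagings); (3.26) p. 395: *«Δ_a(U) = Δ(U) + D_U R(U) D*_U + Q*(U)aQ(U)»*; p. 395: *«It coincides with Δ_a in (2.19) [of
ref. [4]] if U = 1»*; Thm 3.11 p. 416: *«In [4] we have proved that the operator G_□(1) is positive»*.  [Balaban1984PropagatorsI] p. 27: *«(1.55)
Q_k∂ = ∂₁Q′_k»*, *«∂₁ is the unit lattice differentiation»*, *«we can identify Q_kA₀ = B₀»*; p. 22: *«Q′_k transforms constant functions on the
η-lattice into constant functions on the unit lattice»*; p. 30: *«Using (1.55) we have QA = ∂₁Q′Δ⁻²Q′*(Q′Δ⁻²Q′*)⁻¹ω + A₀ = ∂₁ω + A₀ = 0 … A₀ = 0,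
so A = 0 and the positivity of Δ_a follows.»*  [Balaban1985Averaging] (124)–(125) p. 36 (the linear form `Q(V₀)A`; at `V₀ = 1` only the main
term survives), (127) p. 37 (the composites).

WHY THIS FILE (cell context).  `B9Eq326OperatorTower` (E167, this lineage gen 78) assembled the `(n+1)`-level operator `laplaceAk` with the COMPOSITE
averagings `QkW = Q_{n+1}(U)`, `QprimeTowerW = Q′_{n+1}(U)` and defined `G1k ∕ H1k ∕ frakGk` at a DISPLAYED positivity `hpos`; `B5Eq172FlatCoercivity`
(gen 79) proved the flat positivity of the ONE-STEP operator from the Hodge package of `B5Eq172HodgePositivity` §4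
(`exists_coercive_laplaceALatticeK_of_hodge`, generic in the averaging letters `Q`, `Q′`, `∂₁`).  This file feeds THE SAME junction with the TOWER
letters: the two flat averaging identities it needs — (H2) = (1.55)_k and (H3) = «Q_kA₀ = B₀», (H5) = p. 22 for `Q′_k` — are proved along the tower
by induction on the number of levels from the landed one-step identities of NE9 leaf-01 (`B5Eq155FlatAveragingCommute`: `linQ_perCfg_flatGrad`,
`sum_blockOf_eq_sum_boxVec`), leaf-02 (`B5Eq157AveragedConstants.QtorusLin_one_constDir_eq`; `B9Eq315QTowerFlat.UlevOf_one`) and this lineage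
(`B5Eq172FlatCoercivity.card_blockOf`, `inner_dC_const`).

WHAT IS PROVED (sorry-free; proof lane — no `def`, no `Prop` placeholder, no inequality of the papers).
* §1 ONE STEP at a background PROVABLY flat (`V = 1`; the displayed data `(α, hα1, hU1, hreg)` ride along by `subst`): `QtorusLin_constDir_of_eq_one`;
  **`QtorusLin_comp_covDeriv_of_eq_one`** — (1.55) AS AN IDENTITY OF LINEAR MAPS on `𝔸`-valued functions of the torus `T_{L·P} → T_P`:
  `Q(1) ∘ D_c = D_{c∕L} ∘ Q′(1)` with `D_c := B9Eq33CovDerivVector.covDeriv c (fun _ ↦ id)` on both tori and `Q′(1) := QprimeLin L P (fun _ ↦ id)`;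
  `QprimeLin_id_const` (p. 22 at one step); `QprimeLin_id_comp_map` (plain block means commute with a linear fibre map).
* §2 THE TOWER (induction on levels, `Qtower_succ` ∕ `QprimeTower_succ`): **`Qtower_constDir_of_flat`** (`Q_n(1)(b ↦ v_{κ(b)}) = (c ↦ v_{κ(c)})` for
  every level family provably flat — the DIRECTION-WISE constants of the Hodge package; `B9Eq315QTowerFlat.Qtower_one_const` is the κ-independent
  case), **`Qtower_comp_covDeriv_of_flat`** ((1.55)_n: `Q_n(1) ∘ D_c = D_{(L⁻¹)^n·c} ∘ Q′_n(1)`), `QprimeTower_id_const`, `QprimeTower_id_comp_map`.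
* §3 THE `L²` READINGS on the finest torus `T_{L^{n+1} m}` at `U ≡ 1`, for ANY displayed tower data `(α, hα1, hU1, hreg)` of `B9Eq326OperatorTower`:
  **`QkW_one_comp_covDerivL2K`** (the `h155` binder of `exists_coercive_laplaceALatticeK_of_hodge` at `Q := QkW … 1 …`, `Q′ := QprimeTowerW L m n φ 1`,
  `∂₁ := covDerivL2K ℂ c₁ ((L^{n+1}·η)⁻¹) id ∘ (WL2.linearEquiv …).symm` on the unit torus), **`QkW_one_constBond`** (`Q_{n+1}(1)` of a constant vector
  function is the constant vector function with the same value vector ⇒ `hQHarm`, `hQinj`), **`QprimeTowerW_one_const`** (⇒ `hLift`).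
* §4 MAIN **`exists_coercive_principalk_one`** (principal letters `principalOpK φ η 1`) and **`exists_coercive_laplaceAk_one`**: for `η ≠ 0`, `a > 0` there is `γ > 0` with `γ‖x‖² ≤ re⟨x, laplaceAk L m n φ η 1 hL α hα1 hU1 hreg τ a x⟩`
  for all `x`; **`laplaceAk_one_pos`**: `0 < re⟨x, Δ_a(1)x⟩` for `x ≠ 0` — E167's DISPLAYED `hpos` AT THE FLAT BACKGROUND, a theorem at every number
  of levels ((H0) `hessOp_one` + `re_inner_principalOpK_one`; (H1) `hodge_flat` on `T_{L^{n+1}m}`; (H4) `inner_dC_const`).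
* §5 CLOSED FORM **`laplaceAk_one_pos₀`** with NE9 leaf-02's inhabited flat tower data (`perCfg_UlevOf_one_mem_U1`, `norm_Wcx_UlevOf_one_sub_one_le` at
  the profile `α := 0`): only `1 ≤ L`, `η ≠ 0`, `a > 0` remain; **`exists_coercive_laplaceAk_of_near_flat`**: the SHAPE of [B9] Thm 3.11's second
  half at `n+1` levels — the flat `γ₀` degrades to `γ₀ − δ` at every background whose `(n+1)`-level operator is `δ`-close to the flat one
  (`B5Eq172HodgePositivity.coercive_of_sub_le`); the closeness is DISPLAYED (print: (3.35)–(3.37) via (3.86)).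
MODEL ∕ DECLARED READINGS.  (M1)–(M4) as `B9Eq326OperatorTower` (per-level displayed data, fibre readings `φ`∕`τ`, weights `c₀`∕`c₁`, scalar `η⁻¹`,
one number `a`, the fine-lattice Hessian).  (M5) the coarse differentiation `∂₁` carries the scalar `(L^{n+1}η)⁻¹` — print's «unit lattice
differentiation» when `L^{n+1}η = 1`; any nonzero scalar serves the Hodge package.  HONEST SCOPE: [folklore] flat-background linear algebra one storey
up — composition of landed one-step identities by induction + the gen-79 Hodge junction BY NAME; `γ` a finite-lattice number (uniformity = [B5]
(1.90) ∕ [B9] Thm 3.11's α₀ — NOT here); the `(n+1)`-level `hpos` at a GENERAL small field stays displayed; NOT summit progress (cell pub-balaban: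
NE9 NOT PRINTED ∕ NOT PROVED; row WALLED ON A MODEL; spine PROVED 0∕9).  NEW file; nothing modified.  Net new unproved facts: 0.
-/

noncomputable section

open scoped InnerProductSpace ComplexConjugate BigOperators

namespace Literature.MathematicalPhysics.QuantumFieldTheory.Balaban1983to89.B9Eq326OperatorTowerFlat

open B4Sect5Torus (TSite)
open B9SectCLatticeCarrier (Bond shift bpos btgt)
open B7Prop1Explicit (U1 Wcx boxVec)
open B7Prop3GeneralLinear (linQcov_one_left)
open B9Eq33CovDerivVector (covDeriv covDeriv_apply)
open B9Eq311L2Pairing (WL2)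
open B9Eq319QprimeTorus (fineP Qprime_flat QprimeLin QprimeLin_apply)
open B9Eq315QTorus (perSite perCfg perCfg_apply cornerSite QtorusLin QtorusLin_apply)
open B9Eq315QTower (towerP UlevOf Qtower Qtower_succ QkOfU QprimeTower QprimeTower_succ)
open B9Eq315QTowerFlat (UlevOf_one perCfg_UlevOf_one_mem_U1 norm_Wcx_UlevOf_one_sub_one_le)
open B9Eq326OperatorTower (QprimeTowerW QkW RofUk laplaceAk)
open B9Eq310HessianOperator (adTransportW principalOpK covCurlL2K hessOp hessOp_one)
open B11Eq103H1Complex (SiteL2K BondL2K covDerivL2K equiv_covDerivL2K laplaceALatticeK RLatticeK)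
open B5Eq155FlatAveragingCommute (linQ_perCfg_flatGrad sum_blockOf_eq_sum_boxVec norm_perCfg_le)
open B5Eq157AveragedConstants (QtorusLin_one_constDir_eq)
open B5Eq172PoincareTorus (constBond constBond_apply constBondL2K equiv_constBondL2K eq_zero_of_constBondL2K_eq_zero hodge_flat covDerivL2K_const
  const_of_covDeriv_eq_zero)
open B5Eq172HodgePositivity (adTransportW_one hRS_one conj_inv_ofReal re_inner_principalOpK_one covCurlL2K_eq_zero_of_re_inner_principalOpK_one
  exists_coercive_laplaceALatticeK_of_hodge coercive_of_sub_le)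
open B5Eq172FlatCoercivity (card_blockOf inner_dC_const)

variable {d : ℕ} (L : ℕ) [NeZero L]

/-! ## §1 One step at a background provably flat -/

section OneStep

variable {𝔸 : Type*} [NormedRing 𝔸] [NormedAlgebra ℂ 𝔸] [CompleteSpace 𝔸] [NormOneClass 𝔸]
  (P : Fin d → ℕ) [∀ i, NeZero (P i)] (hL : 1 ≤ L)
  {V : Bond d (fineP L P) → 𝔸ˣ} (hV : V = fun _ => 1) {α : ℝ} (hα1 : α ≤ 1 / 64)
  (hU1 : ∀ (x : B7Prop1Explicit.Site d) (κ : Fin d), perCfg (fineP L P) V x κ ∈ U1 𝔸)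
  (hreg : ∀ (y : TSite d P) (κ : Fin d) (r : Fin d → Fin L), ‖((Wcx L (perCfg (fineP L P) V) (cornerSite L y) κ (boxVec L r) : 𝔸ˣ) : 𝔸) - 1‖ ≤ α)

include hL hV in
/-- **«Q_kA₀ = B₀» at one step, at a background PROVABLY flat** (the displayed data are transported along `V = 1`): the one-step vector averaging
reproduces direction-wise constants, `Q(V)(b ↦ v_{κ(b)}) = (c ↦ v_{κ(c)})` (NE9 leaf-02's `QtorusLin_one_constDir_eq`).
[cite: Balaban1984PropagatorsI, p.27; Balaban1985BackgroundPropagators, (3.15) p.393] -/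
theorem QtorusLin_constDir_of_eq_one (v : Fin d → 𝔸) : QtorusLin L P hL V hα1 hU1 hreg (fun b => v b.2) = fun c => v c.2 := by
  subst hV; exact QtorusLin_one_constDir_eq L P hL hα1 hU1 hreg v

include hL hV in
/-- **[B5] (1.55) `Q∂ = ∂₁Q′` AT ONE STEP, AS AN IDENTITY OF LINEAR MAPS on `𝔸`-valued functions, at a background provably flat**: the one-step
vector averaging (3.15) composed with the flat gradient of scalar `c` IS the flat gradient of scalar `c∕L` composed with the plain block mean
(3.19) — every spine segment of the main term (125) telescopes (NE9 leaf-01's `linQ_perCfg_flatGrad`), the frame terms of (124) vanish at `V₀ = 1`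
(`linQcov_one_left`). [cite: Balaban1984PropagatorsI, (1.55) p.27; Balaban1985Averaging, (124)–(125) p.36; Balaban1985BackgroundPropagators, (3.15) p.393, (3.19) p.393] -/
theorem QtorusLin_comp_covDeriv_of_eq_one (c : ℂ) :
    QtorusLin L P hL V hα1 hU1 hreg ∘ₗ covDeriv c (fun _ : Bond d (fineP L P) => (LinearMap.id : 𝔸 →ₗ[ℂ] 𝔸)) =
      covDeriv (((L : ℂ))⁻¹ * c) (fun _ : Bond d P => (LinearMap.id : 𝔸 →ₗ[ℂ] 𝔸)) ∘ₗ
        QprimeLin L P (fun _ : Bond d (fineP L P) => (LinearMap.id : 𝔸 →ₗ[ℂ] 𝔸)) := by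
  subst hV
  apply LinearMap.ext
  intro g
  funext cb
  obtain ⟨y, κ⟩ := cb
  have hD : covDeriv c (fun _ : Bond d (fineP L P) => (LinearMap.id : 𝔸 →ₗ[ℂ] 𝔸)) g = fun b => c • (g (btgt b) - g (bpos b)) := by
    funext b; rw [covDeriv_apply]; rfl
  have hid : (fun b : Bond d (fineP L P) => ((LinearMap.id : 𝔸 →ₗ[ℂ] 𝔸)).restrictScalars ℝ) = fun _ => (LinearMap.id : 𝔸 →ₗ[ℝ] 𝔸) := rfl
  rw [LinearMap.comp_apply, LinearMap.comp_apply, QtorusLin_apply, hD,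
    show perCfg (fineP L P) (fun _ : Bond d (fineP L P) => (1 : 𝔸ˣ)) = 1 from rfl,
    linQcov_one_left L hL _ (Finset.sum_nonneg fun b _ => norm_nonneg _) (norm_perCfg_le _), linQ_perCfg_flatGrad L P g c y κ,
    covDeriv_apply, LinearMap.id_apply, QprimeLin_apply, hid]
  change _ = _ • (B9Eq319QprimeTorus.Qprime L P _ g (shift κ y) - B9Eq319QprimeTorus.Qprime L P _ g y)
  rw [Qprime_flat, Qprime_flat, sum_blockOf_eq_sum_boxVec, sum_blockOf_eq_sum_boxVec, ← Finset.sum_sub_distrib, Finset.smul_sum, Finset.smul_sum]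
  refine Finset.sum_congr rfl fun r _ => ?_
  rw [← smul_sub, ← Complex.coe_smul, ← Complex.coe_smul, smul_smul, smul_smul, smul_smul]
  congr 1
  ring

omit [CompleteSpace 𝔸] [NormOneClass 𝔸] [∀ i, NeZero (P i)] in
/-- **p. 22 at one step: the plain block mean of a constant site function is the constant** (`|B(y)| = L^d` against the weight `L^{−d}`), for
`V`-valued functions of any `ℂ`-module. [cite: Balaban1984PropagatorsI, p.22; Balaban1985BackgroundPropagators, (3.19) p.393] -/
theorem QprimeLin_id_const {W : Type*} [AddCommGroup W] [Module ℂ W] (w : W) :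
    QprimeLin L P (fun _ : Bond d (fineP L P) => (LinearMap.id : W →ₗ[ℂ] W)) (fun _ => w) = fun _ => w := by
  have hL0 : ((L : ℝ)) ^ d ≠ 0 := pow_ne_zero _ (Nat.cast_ne_zero.2 (NeZero.ne L))
  have hid : (fun b : Bond d (fineP L P) => ((LinearMap.id : W →ₗ[ℂ] W)).restrictScalars ℝ) = fun _ => (LinearMap.id : W →ₗ[ℝ] W) := rfl
  funext y
  rw [QprimeLin_apply, hid, Qprime_flat, Finset.sum_const, card_blockOf, ← Nat.cast_smul_eq_nsmul ℝ, Nat.cast_pow, smul_smul,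
    mul_inv_cancel₀ hL0, one_smul]

omit [CompleteSpace 𝔸] [NormOneClass 𝔸] [∀ i, NeZero (P i)] in
/-- **The plain block mean commutes with a linear fibre map** `φ : W → W′` (both `Q′(1)`s are `Σ_{x∈B(y)} L^{−d}(·)`).
[cite: Balaban1985BackgroundPropagators, (3.19) p.393] -/
theorem QprimeLin_id_comp_map {W W' : Type*} [AddCommGroup W] [Module ℂ W] [AddCommGroup W'] [Module ℂ W'] (φ : W →ₗ[ℂ] W')
    (l : TSite d (fineP L P) → W) :
    QprimeLin L P (fun _ : Bond d (fineP L P) => (LinearMap.id : W' →ₗ[ℂ] W')) (fun x => φ (l x)) =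
      fun y => φ (QprimeLin L P (fun _ : Bond d (fineP L P) => (LinearMap.id : W →ₗ[ℂ] W)) l y) := by
  have hid : (fun b : Bond d (fineP L P) => ((LinearMap.id : W →ₗ[ℂ] W)).restrictScalars ℝ) = fun _ => (LinearMap.id : W →ₗ[ℝ] W) := rfl
  have hid' : (fun b : Bond d (fineP L P) => ((LinearMap.id : W' →ₗ[ℂ] W')).restrictScalars ℝ) = fun _ => (LinearMap.id : W' →ₗ[ℝ] W') := rfl
  funext y
  rw [QprimeLin_apply, QprimeLin_apply, hid, hid', Qprime_flat, Qprime_flat, map_sum]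
  refine Finset.sum_congr rfl fun x _ => ?_
  rw [← Complex.coe_smul, ← Complex.coe_smul, map_smul]

end OneStep

/-! ## §2 The tower: direction-wise constants and (1.55) along `n` levels -/

section Tower

variable {𝔸 : Type*} [NormedRing 𝔸] [NormedAlgebra ℂ 𝔸] [CompleteSpace 𝔸] [NormOneClass 𝔸]
  (m : Fin d → ℕ) [∀ i, NeZero (m i)] (hL : 1 ≤ L)
  {Ulev : (n : ℕ) → Bond d (towerP L m (n + 1)) → 𝔸ˣ} (hflat : ∀ n, Ulev n = fun _ => 1) (α : ℕ → ℝ) (hα1 : ∀ n, α n ≤ 1 / 64)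
  (hU1 : ∀ (n : ℕ) (x : B7Prop1Explicit.Site d) (κ : Fin d), perCfg (towerP L m (n + 1)) (Ulev n) x κ ∈ U1 𝔸)
  (hreg : ∀ (n : ℕ) (y : TSite d (towerP L m n)) (κ : Fin d) (r : Fin d → Fin L),
    ‖((Wcx L (perCfg (towerP L m (n + 1)) (Ulev n)) (cornerSite L y) κ (boxVec L r) : 𝔸ˣ) : 𝔸) - 1‖ ≤ α n)

include hL hflat in
/-- **«Q_kA₀ = B₀» ALONG THE TOWER**: for a level family PROVABLY flat, the composite `Q_n` reproduces direction-wise constants,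
`Q_n(b ↦ v_{κ(b)}) = (c ↦ v_{κ(c)})` — `n` one-step factors (§1). [cite: Balaban1984PropagatorsI, p.27; Balaban1985BackgroundPropagators, (3.15) p.393] -/
theorem Qtower_constDir_of_flat (v : Fin d → 𝔸) :
    ∀ n : ℕ, Qtower L m hL Ulev α hα1 hU1 hreg n (fun b => v b.2) = fun c => v c.2
  | 0 => rfl
  | n + 1 => by
    show Qtower L m hL Ulev α hα1 hU1 hreg n
        (QtorusLin L (towerP L m n) hL (Ulev n) (hα1 n) (hU1 n) (hreg n) fun b => v b.2) = fun c => v c.2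
    rw [QtorusLin_constDir_of_eq_one L (towerP L m n) hL (hflat n) (hα1 n) (hU1 n) (hreg n) v]
    exact Qtower_constDir_of_flat v n

include hL hflat in
/-- **[B5] (1.55)_n `Q_n∂ = ∂₁Q′_n` ALONG THE TOWER, as an identity of linear maps on `𝔸`-valued functions**: for a level family provably flat,
`Q_n ∘ D_c = D_{(L⁻¹)^n·c} ∘ Q′_n(1)` — the finest factor first, one power of `L⁻¹` per level.
[cite: Balaban1984PropagatorsI, (1.55) p.27; Balaban1985BackgroundPropagators, (3.15) p.393, (3.19) p.393] -/
theorem Qtower_comp_covDeriv_of_flat :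
    ∀ (n : ℕ) (c : ℂ), Qtower L m hL Ulev α hα1 hU1 hreg n ∘ₗ covDeriv c (fun _ : Bond d (towerP L m n) => (LinearMap.id : 𝔸 →ₗ[ℂ] 𝔸)) =
      covDeriv ((((L : ℂ))⁻¹) ^ n * c) (fun _ : Bond d m => (LinearMap.id : 𝔸 →ₗ[ℂ] 𝔸)) ∘ₗ
        QprimeTower L m (fun _ _ => (LinearMap.id : 𝔸 →ₗ[ℂ] 𝔸)) n
  | 0, c => by
    rw [pow_zero, one_mul]
    exact LinearMap.ext fun _ => rfl
  | n + 1, c => by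
    show (Qtower L m hL Ulev α hα1 hU1 hreg n ∘ₗ QtorusLin L (towerP L m n) hL (Ulev n) (hα1 n) (hU1 n) (hreg n)) ∘ₗ
        covDeriv c (fun _ : Bond d (fineP L (towerP L m n)) => (LinearMap.id : 𝔸 →ₗ[ℂ] 𝔸)) =
      covDeriv ((((L : ℂ))⁻¹) ^ (n + 1) * c) (fun _ : Bond d m => (LinearMap.id : 𝔸 →ₗ[ℂ] 𝔸)) ∘ₗ
        (QprimeTower L m (fun _ _ => (LinearMap.id : 𝔸 →ₗ[ℂ] 𝔸)) n ∘ₗ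
          QprimeLin L (towerP L m n) (fun _ : Bond d (fineP L (towerP L m n)) => (LinearMap.id : 𝔸 →ₗ[ℂ] 𝔸)))
    rw [LinearMap.comp_assoc, QtorusLin_comp_covDeriv_of_eq_one L (towerP L m n) hL (hflat n) (hα1 n) (hU1 n) (hreg n) c,
      ← LinearMap.comp_assoc, Qtower_comp_covDeriv_of_flat n, LinearMap.comp_assoc, pow_succ,
      show ((L : ℂ))⁻¹ ^ n * ((L : ℂ))⁻¹ * c = ((L : ℂ))⁻¹ ^ n * (((L : ℂ))⁻¹ * c) from mul_assoc _ _ _]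

omit [CompleteSpace 𝔸] [NormOneClass 𝔸] [∀ i, NeZero (m i)] in
/-- **p. 22 ALONG THE TOWER: `Q′_n(1)` of a constant is the constant.** [cite: Balaban1984PropagatorsI, p.22; Balaban1985BackgroundPropagators, (3.19) p.393] -/
theorem QprimeTower_id_const {W : Type*} [AddCommGroup W] [Module ℂ W] (w : W) :
    ∀ n : ℕ, QprimeTower L m (fun _ _ => (LinearMap.id : W →ₗ[ℂ] W)) n (fun _ => w) = fun _ => w
  | 0 => rfl
  | n + 1 => by
    show QprimeTower L m (fun _ _ => (LinearMap.id : W →ₗ[ℂ] W)) n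
        (QprimeLin L (towerP L m n) (fun _ : Bond d (fineP L (towerP L m n)) => (LinearMap.id : W →ₗ[ℂ] W)) fun _ => w) = fun _ => w
    rw [QprimeLin_id_const L (towerP L m n) w]
    exact QprimeTower_id_const w n

omit [CompleteSpace 𝔸] [NormOneClass 𝔸] [∀ i, NeZero (m i)] in
/-- **`Q′_n(1)` commutes with a linear fibre map.** [cite: Balaban1985BackgroundPropagators, (3.19) p.393] -/
theorem QprimeTower_id_comp_map {W W' : Type*} [AddCommGroup W] [Module ℂ W] [AddCommGroup W'] [Module ℂ W'] (φ : W →ₗ[ℂ] W') :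
    ∀ (n : ℕ) (l : TSite d (towerP L m n) → W),
      QprimeTower L m (fun _ _ => (LinearMap.id : W' →ₗ[ℂ] W')) n (fun x => φ (l x)) =
        fun y => φ (QprimeTower L m (fun _ _ => (LinearMap.id : W →ₗ[ℂ] W)) n l y)
  | 0, l => rfl
  | n + 1, l => by
    show QprimeTower L m (fun _ _ => (LinearMap.id : W' →ₗ[ℂ] W')) n
        (QprimeLin L (towerP L m n) (fun _ : Bond d (fineP L (towerP L m n)) => (LinearMap.id : W' →ₗ[ℂ] W')) fun x => φ (l x)) =
      fun y => φ (QprimeTower L m (fun _ _ => (LinearMap.id : W →ₗ[ℂ] W)) n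
        (QprimeLin L (towerP L m n) (fun _ : Bond d (fineP L (towerP L m n)) => (LinearMap.id : W →ₗ[ℂ] W)) l) y)
    rw [QprimeLin_id_comp_map L (towerP L m n) φ l]
    exact QprimeTower_id_comp_map φ n _

end Tower

/-! ## §3 The `L²` readings on the finest torus at the flat background -/

section Readings

variable {𝔸 : Type*} [NormedRing 𝔸] [NormedAlgebra ℂ 𝔸] [CompleteSpace 𝔸] [NormOneClass 𝔸]
  (m : Fin d → ℕ) [∀ i, NeZero (m i)] (n : ℕ) (hL : 1 ≤ L)
  {W : Type*} [NormedAddCommGroup W] [InnerProductSpace ℂ W] (φ : W ≃ₗ[ℂ] 𝔸) {c₀ c₁ : ℝ} (η : ℝ)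
  (α : ℕ → ℝ) (hα1 : ∀ j, α j ≤ 1 / 64)
  (hU1 : ∀ (j : ℕ) (x : B7Prop1Explicit.Site d) (κ : Fin d),
    perCfg (towerP L m (j + 1)) (UlevOf L m (n + 1) (fun _ : Bond d (towerP L m (n + 1)) => (1 : 𝔸ˣ)) j) x κ ∈ U1 𝔸)
  (hreg : ∀ (j : ℕ) (y : TSite d (towerP L m j)) (κ : Fin d) (r : Fin d → Fin L),
    ‖((Wcx L (perCfg (towerP L m (j + 1)) (UlevOf L m (n + 1) (fun _ : Bond d (towerP L m (n + 1)) => (1 : 𝔸ˣ)) j)) (cornerSite L y) κ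
      (boxVec L r) : 𝔸ˣ) : 𝔸) - 1‖ ≤ α j)

/-- The fibre identifications of `QkW` read pointwise: the function underlying `QkW … U … f` at a coarse bond `c` is
`φ⁻¹ (Q_{n+1}(U)(φ ∘ f)(c))`. [cite: Balaban1985BackgroundPropagators, (3.15)–(3.16) p.393] -/
theorem equiv_QkW (U : Bond d (towerP L m (n + 1)) → 𝔸ˣ)
    (hU1' : ∀ (j : ℕ) (x : B7Prop1Explicit.Site d) (κ : Fin d), perCfg (towerP L m (j + 1)) (UlevOf L m (n + 1) U j) x κ ∈ U1 𝔸)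
    (hreg' : ∀ (j : ℕ) (y : TSite d (towerP L m j)) (κ : Fin d) (r : Fin d → Fin L),
      ‖((Wcx L (perCfg (towerP L m (j + 1)) (UlevOf L m (n + 1) U j)) (cornerSite L y) κ (boxVec L r) : 𝔸ˣ) : 𝔸) - 1‖ ≤ α j)
    (f : BondL2K ℂ d (towerP L m (n + 1)) c₀ W) (c : Bond d m) :
    WL2.equiv ℂ _ W (QkW L m n φ U hL α hα1 hU1' hreg' (c₀ := c₀) (c₁ := c₁) f) c =
      φ.symm (QkOfU L m hL (n + 1) U α hα1 hU1' hreg' (fun b => φ (WL2.equiv ℂ _ W f b)) c) := rfl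

omit [NormOneClass 𝔸] in
/-- The transporter family of `Q′_{n+1}(1)` is the identity family. [cite: Balaban1985BackgroundPropagators, (3.19) p.393, p.395] -/
theorem adTransportW_UlevOf_one :
    (fun j => adTransportW φ (UlevOf L m (n + 1) (fun _ : Bond d (towerP L m (n + 1)) => (1 : 𝔸ˣ)) j)) =
      fun _ _ => (LinearMap.id : W →ₗ[ℂ] W) := by
  funext j b
  rw [UlevOf_one, adTransportW_one]

omit [NormOneClass 𝔸] in
/-- The function underlying `QprimeTowerW … 1 … l` is `Q′_{n+1}(1)` (identity transporters) of the function underlying `l`.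
[cite: Balaban1985BackgroundPropagators, (3.19) p.393] -/
theorem QprimeTowerW_one_apply (l : SiteL2K ℂ d (towerP L m (n + 1)) c₀ W) :
    QprimeTowerW L m n φ (fun _ : Bond d (towerP L m (n + 1)) => (1 : 𝔸ˣ)) (c₀ := c₀) l =
      QprimeTower L m (fun _ _ => (LinearMap.id : W →ₗ[ℂ] W)) (n + 1) (WL2.equiv ℂ _ W l) := by
  rw [QprimeTowerW, adTransportW_UlevOf_one]
  rfl

omit [NormOneClass 𝔸] in
/-- **p. 22 FOR `Q′_{n+1}(1)` ON THE `L²` GAUGE PARAMETERS: the composite site averaging of the constant fine function `w` is the constant coarse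
function `w`.** [cite: Balaban1984PropagatorsI, p.22; Balaban1985BackgroundPropagators, (3.19) p.393] -/
theorem QprimeTowerW_one_const (w : W) :
    QprimeTowerW L m n φ (fun _ : Bond d (towerP L m (n + 1)) => (1 : 𝔸ˣ)) (c₀ := c₀)
        ((WL2.equiv ℂ (fun _ : TSite d (towerP L m (n + 1)) => c₀) W).symm fun _ => w) = fun _ => w := by
  rw [QprimeTowerW_one_apply, Equiv.apply_symm_apply]
  exact QprimeTower_id_const L m w (n + 1)

include hL in
/-- **«Q_kA₀ = B₀» ON THE `L²` LETTERS: `Q_{n+1}(1)` maps the fine constant vector function with value vector `v : Fin d → W` (weight `c₀`) to the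
coarse constant vector function with the SAME value vector (weight `c₁`)** — (H3) of the Hodge package for the tower.
[cite: Balaban1984PropagatorsI, p.27, (1.72) p.30; Balaban1985BackgroundPropagators, (3.15)–(3.16) p.393] -/
theorem QkW_one_constBond (v : Fin d → W) :
    QkW L m n φ (fun _ : Bond d (towerP L m (n + 1)) => (1 : 𝔸ˣ)) hL α hα1 hU1 hreg (c₀ := c₀) (c₁ := c₁)
        (constBondL2K (towerP L m (n + 1)) ℂ c₀ v) = constBondL2K m ℂ c₁ v := by
  apply (WL2.equiv ℂ (fun _ : Bond d m => c₁) W).injective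
  funext c
  rw [equiv_QkW, equiv_constBondL2K, equiv_constBondL2K, constBond_apply]
  have h := Qtower_constDir_of_flat L m hL (Ulev := UlevOf L m (n + 1) (fun _ : Bond d (towerP L m (n + 1)) => (1 : 𝔸ˣ)))
    (UlevOf_one L m (n + 1)) α hα1 hU1 hreg (fun κ => φ (v κ)) (n + 1)
  have h' : (fun b : Bond d (towerP L m (n + 1)) => φ (constBond v b)) = fun b => φ (v b.2) := rfl
  rw [QkOfU, h', h, LinearEquiv.symm_apply_apply]

include hL in
/-- **[B5] (1.55)_{n+1} ON THE `L²` LETTERS OF `B9Eq326OperatorTower`, FLAT BACKGROUND** — LITERALLY the `h155` binder of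
`B5Eq172HodgePositivity.exists_coercive_laplaceALatticeK_of_hodge` at `Q := Q_{n+1}(1)`, `Q′ := Q′_{n+1}(1)` and the coarse flat gradient of scalar
`(L^{n+1}·η)⁻¹` read into the weighted `L²` space of the unit torus: `Q_{n+1}(1) ∘ D = ∂₁ ∘ Q′_{n+1}(1)`.
[cite: Balaban1984PropagatorsI, (1.55) p.27; Balaban1985BackgroundPropagators, (3.3) p.391, (3.15) p.393, (3.19) p.393] -/
theorem QkW_one_comp_covDerivL2K [Fact (0 < c₀)] [Fact (0 < c₁)] :
    QkW L m n φ (fun _ : Bond d (towerP L m (n + 1)) => (1 : 𝔸ˣ)) hL α hα1 hU1 hreg (c₀ := c₀) (c₁ := c₁) ∘ₗ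
        covDerivL2K ℂ c₀ ((η : ℂ))⁻¹ (adTransportW φ (fun _ : Bond d (towerP L m (n + 1)) => (1 : 𝔸ˣ))) =
      (covDerivL2K ℂ c₁ (((((L : ℝ) ^ (n + 1) * η)⁻¹ : ℝ) : ℂ)) (fun _ : Bond d m => (LinearMap.id : W →ₗ[ℂ] W)) ∘ₗ
          (WL2.linearEquiv ℂ ℂ (fun _ : TSite d m => c₁)).symm.toLinearMap) ∘ₗ
        QprimeTowerW L m n φ (fun _ : Bond d (towerP L m (n + 1)) => (1 : 𝔸ˣ)) := by
  apply LinearMap.ext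
  intro l
  apply (WL2.equiv ℂ (fun _ : Bond d m => c₁) W).injective
  funext c
  -- the scalar bookkeeping `(L⁻¹)^{n+1} · η⁻¹ = ((L^{n+1} η)⁻¹ : ℝ)`
  have hsc : ((((L : ℂ))⁻¹) ^ (n + 1) * ((η : ℂ))⁻¹) = (((((L : ℝ) ^ (n + 1) * η)⁻¹ : ℝ) : ℂ)) := by
    push_cast
    rw [mul_inv, inv_pow]
  -- left-hand side: `φ⁻¹ (Q_{n+1}(1)(φ ∘ D_{η⁻¹} l)(c))`, and `φ ∘ D l = D (φ ∘ l)` at the identity transporter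
  have hφD : (fun b => φ (WL2.equiv ℂ _ W (covDerivL2K ℂ c₀ ((η : ℂ))⁻¹
      (adTransportW φ (fun _ : Bond d (towerP L m (n + 1)) => (1 : 𝔸ˣ))) l) b)) =
      covDeriv ((η : ℂ))⁻¹ (fun _ : Bond d (towerP L m (n + 1)) => (LinearMap.id : 𝔸 →ₗ[ℂ] 𝔸)) (fun x => φ (WL2.equiv ℂ _ W l x)) := by
    funext b
    rw [equiv_covDerivL2K, covDeriv_apply, covDeriv_apply, adTransportW_one, LinearMap.id_apply, LinearMap.id_apply, map_smul, map_sub]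
  have hT := congrArg (fun T => T (fun x => φ (WL2.equiv ℂ _ W l x)) c)
    (Qtower_comp_covDeriv_of_flat L m hL (Ulev := UlevOf L m (n + 1) (fun _ : Bond d (towerP L m (n + 1)) => (1 : 𝔸ˣ)))
      (UlevOf_one L m (n + 1)) α hα1 hU1 hreg (n + 1) ((η : ℂ))⁻¹)
  simp only [LinearMap.comp_apply] at hT
  have hcm := QprimeTower_id_comp_map L m φ.toLinearMap (n + 1) (WL2.equiv ℂ _ W l)
  simp only [LinearEquiv.coe_toLinearMap] at hcm
  -- left-hand side
  rw [LinearMap.comp_apply, equiv_QkW, QkOfU, hφD, hT, covDeriv_apply, LinearMap.id_apply, hcm, hsc, map_smul, map_sub,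
    LinearEquiv.symm_apply_apply, LinearEquiv.symm_apply_apply]
  -- right-hand side
  rw [LinearMap.comp_apply, LinearMap.comp_apply, equiv_covDerivL2K, covDeriv_apply, LinearMap.id_apply, LinearEquiv.coe_toLinearMap,
    WL2.linearEquiv_symm_apply, Equiv.apply_symm_apply, QprimeTowerW_one_apply]

end Readings

/-! ## §4 MAIN: the flat positivity of the `(n+1)`-level operator `Δ_a(1)` -/

section Main

variable {𝔸 : Type*} [NormedRing 𝔸] [NormedAlgebra ℂ 𝔸] [CompleteSpace 𝔸] [NormOneClass 𝔸] [StarRing 𝔸] [StarModule ℂ 𝔸]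
  (m : Fin d → ℕ) [∀ i, NeZero (m i)] (n : ℕ) (hL : 1 ≤ L)
  {W : Type*} [NormedAddCommGroup W] [InnerProductSpace ℂ W] [FiniteDimensional ℂ W] (φ : W ≃ₗ[ℂ] 𝔸) {c₀ c₁ : ℝ} [Fact (0 < c₀)] [Fact (0 < c₁)]
  {η : ℝ} (hη : η ≠ 0) (α : ℕ → ℝ) (hα1 : ∀ j, α j ≤ 1 / 64)
  (hU1 : ∀ (j : ℕ) (x : B7Prop1Explicit.Site d) (κ : Fin d),
    perCfg (towerP L m (j + 1)) (UlevOf L m (n + 1) (fun _ : Bond d (towerP L m (n + 1)) => (1 : 𝔸ˣ)) j) x κ ∈ U1 𝔸)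
  (hreg : ∀ (j : ℕ) (y : TSite d (towerP L m j)) (κ : Fin d) (r : Fin d → Fin L),
    ‖((Wcx L (perCfg (towerP L m (j + 1)) (UlevOf L m (n + 1) (fun _ : Bond d (towerP L m (n + 1)) => (1 : 𝔸ˣ)) j)) (cornerSite L y) κ
      (boxVec L r) : 𝔸ˣ) : 𝔸) - 1‖ ≤ α j)
  (τ : 𝔸 →ₗ[ℂ] ℂ) {a : ℝ} (ha : 0 < a)

include hη ha

omit [StarRing 𝔸] [StarModule ℂ 𝔸] in
/-- **THE FLAT COERCIVITY OF THE `(n+1)`-LEVEL PRINCIPAL GAUGE-FIXED OPERATOR `D*D + D R(1) D* + a Q_{n+1}(1)* Q_{n+1}(1)`** — [B5] p. 30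
«so A = 0 and the positivity of Δ_a follows» with the COMPOSITE averagings `Q_{n+1}`, `Q′_{n+1}`: for `η ≠ 0`, `a > 0` there is `γ > 0` with
`γ‖x‖² ≤ re⟨x, laplaceALatticeK η⁻¹ R(1) R(1)⁻¹ (principalOpK φ η 1) (RofUk L m n φ η 1) (QkW L m n φ 1 …) a x⟩` for all `x`, for ANY displayed
tower data — every member of the Hodge package of `B5Eq172HodgePositivity` §4 PROVED for the tower letters: (H0) `re_inner_principalOpK_one`, (H1)
`hodge_flat` on `T_{L^{n+1}m}`, (H2) §3 `QkW_one_comp_covDerivL2K`, (H3) `QkW_one_constBond`, (H4) `inner_dC_const`, (H5) `QprimeTowerW_one_const` +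
`const_of_covDeriv_eq_zero`.  The constant `γ` is a finite-lattice number (the `hγ`-shape of `Support/NE9CurChartOfBackground.cur_chart_exists_of_principal_coercive`
one storey up). [cite: Balaban1984PropagatorsI, (1.72) p.30, (1.55) p.27; Balaban1985BackgroundPropagators, (3.26) p.395, Thm 3.11 p.416] -/
theorem exists_coercive_principalk_one :
    ∃ γ : ℝ, 0 < γ ∧ ∀ x : BondL2K ℂ d (towerP L m (n + 1)) c₀ W, γ * ‖x‖ ^ 2 ≤
      RCLike.re ⟪x, laplaceALatticeK ((η : ℂ))⁻¹ (adTransportW φ (fun _ : Bond d (towerP L m (n + 1)) => (1 : 𝔸ˣ)))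
        (adTransportW φ fun _ : Bond d (towerP L m (n + 1)) => (1 : 𝔸ˣ)⁻¹) (principalOpK φ η fun _ => 1)
        (RofUk L m n φ η fun _ : Bond d (towerP L m (n + 1)) => (1 : 𝔸ˣ))
        (QkW L m n φ (fun _ : Bond d (towerP L m (n + 1)) => (1 : 𝔸ˣ)) hL α hα1 hU1 hreg (c₁ := c₁)) a x⟫_ℂ := by
  have hc : ((η : ℂ))⁻¹ ≠ 0 := inv_ne_zero (Complex.ofReal_ne_zero.2 hη)
  have hc'r : ((L : ℝ) ^ (n + 1) * η)⁻¹ ≠ 0 := inv_ne_zero (mul_ne_zero (pow_ne_zero _ (Nat.cast_ne_zero.2 (NeZero.ne L))) hη)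
  have hc' : (((((L : ℝ) ^ (n + 1) * η)⁻¹ : ℝ) : ℂ)) ≠ 0 := Complex.ofReal_ne_zero.2 hc'r
  rw [RofUk]
  refine exists_coercive_laplaceALatticeK_of_hodge _ (conj_inv_ofReal η) _ _ (hRS_one φ) _ _ _ a
    (Harm := LinearMap.range (constBondL2K (towerP L m (n + 1)) ℂ c₀)) (HarmC := LinearMap.range (constBondL2K m ℂ c₁))
    (fun x => by rw [re_inner_principalOpK_one]; positivity)
    (fun x hx => hodge_flat hc (adTransportW_one φ) x (covCurlL2K_eq_zero_of_re_inner_principalOpK_one φ η hx))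
    (QkW_one_comp_covDerivL2K L m n hL φ η α hα1 hU1 hreg) ?_ ?_ (fun ω h' hh' => inner_dC_const m ω h' hh') ?_ ha
  · rintro _ ⟨v, rfl⟩
    exact ⟨v, (QkW_one_constBond L m n hL φ α hα1 hU1 hreg v).symm⟩
  · rintro _ ⟨v, rfl⟩ h0
    rw [QkW_one_constBond] at h0
    rw [eq_zero_of_constBondL2K_eq_zero h0, map_zero]
  · intro ω hω
    have hω' : covDeriv (((((L : ℝ) ^ (n + 1) * η)⁻¹ : ℝ) : ℂ)) (fun _ : Bond d m => (LinearMap.id : W →ₗ[ℂ] W)) ω = 0 := by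
      have h := congrArg (WL2.equiv ℂ (fun _ : Bond d m => c₁) W) hω
      rw [LinearMap.comp_apply, equiv_covDerivL2K, WL2.equiv_zero] at h
      exact h
    have hconst : ω = fun _ => ω 0 := funext fun y => const_of_covDeriv_eq_zero hc' (fun _ => rfl) hω' y
    refine ⟨(WL2.equiv ℂ (fun _ : TSite d (towerP L m (n + 1)) => c₀) W).symm fun _ => ω 0,
      covDerivL2K_const _ (adTransportW_one φ) _, ?_⟩
    rw [QprimeTowerW_one_const L m n φ, ← hconst]

/-- **THE FLAT COERCIVITY OF THE `(n+1)`-LEVEL OPERATOR `Δ_a(1)` OF [B9] (3.26)** ([B9] p. 395 «It coincides with Δ_a in (2.19) [4] if U = 1»): for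
`η ≠ 0`, `a > 0` there is `γ > 0` with `γ‖x‖² ≤ re⟨x, laplaceAk L m n φ η 1 hL α hα1 hU1 hreg τ a x⟩` for all `x` — at the flat background the
Hessian (3.10) IS its principal part (`hessOp_one`: `Δ′(1) = 0`), so this is `exists_coercive_principalk_one`.
[cite: Balaban1984PropagatorsI, (1.72) p.30; Balaban1985BackgroundPropagators, (3.26) p.395, (3.10) p.392, Thm 3.11 p.416] -/
theorem exists_coercive_laplaceAk_one :
    ∃ γ : ℝ, 0 < γ ∧ ∀ x : BondL2K ℂ d (towerP L m (n + 1)) c₀ W, γ * ‖x‖ ^ 2 ≤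
      RCLike.re ⟪x, laplaceAk L m n φ η (fun _ : Bond d (towerP L m (n + 1)) => (1 : 𝔸ˣ)) hL α hα1 hU1 hreg τ (c₀ := c₀) (c₁ := c₁) a x⟫_ℂ := by
  rw [laplaceAk, hessOp_one]
  exact exists_coercive_principalk_one L m n hL φ hη α hα1 hU1 hreg ha

/-- **[B9] Thm 3.11 «Δ_a is positive definite» AT THE FLAT BACKGROUND FOR THE `(n+1)`-LEVEL OPERATOR** — the DISPLAYED `hpos` of
`B9Eq326OperatorTower.G1k ∕ H1k ∕ Q_H1k ∕ frakGk` at `U := 1` IS A THEOREM: `0 < re⟨x, Δ_a(1)x⟩` for `x ≠ 0` (`η ≠ 0`, `a > 0`), at every number of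
levels and for any displayed tower data. [cite: Balaban1985BackgroundPropagators, Thm 3.11 p.416, (3.26) p.395; Balaban1984PropagatorsI, (1.72) p.30] -/
theorem laplaceAk_one_pos (x : BondL2K ℂ d (towerP L m (n + 1)) c₀ W) (hx : x ≠ 0) :
    0 < RCLike.re ⟪x, laplaceAk L m n φ η (fun _ : Bond d (towerP L m (n + 1)) => (1 : 𝔸ˣ)) hL α hα1 hU1 hreg τ (c₀ := c₀) (c₁ := c₁) a x⟫_ℂ := by
  obtain ⟨γ, hγ0, hγ⟩ := exists_coercive_laplaceAk_one L m n hL φ (c₀ := c₀) (c₁ := c₁) hη α hα1 hU1 hreg τ ha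
  exact lt_of_lt_of_le (mul_pos hγ0 (by positivity)) (hγ x)

end Main

/-! ## §5 Closed form (the flat tower data inhabited) and the near-flat shape of Thm 3.11's second half -/

section Closed

variable {𝔸 : Type*} [NormedRing 𝔸] [NormedAlgebra ℂ 𝔸] [CompleteSpace 𝔸] [NormOneClass 𝔸] [StarRing 𝔸] [StarModule ℂ 𝔸]
  (m : Fin d → ℕ) [∀ i, NeZero (m i)] (n : ℕ) (hL : 1 ≤ L)
  {W : Type*} [NormedAddCommGroup W] [InnerProductSpace ℂ W] [FiniteDimensional ℂ W] (φ : W ≃ₗ[ℂ] 𝔸) {c₀ c₁ : ℝ} [Fact (0 < c₀)] [Fact (0 < c₁)]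
  {η : ℝ} (hη : η ≠ 0) (τ : 𝔸 →ₗ[ℂ] ℂ) {a : ℝ} (ha : 0 < a)

include hη ha

/-- **CLOSED FORM: [B9] Thm 3.11 at `U = 1` for the `(n+1)`-level operator with the flat tower data INHABITED** (NE9 leaf-02's
`B9Eq315QTowerFlat.perCfg_UlevOf_one_mem_U1` ∕ `norm_Wcx_UlevOf_one_sub_one_le` at the profile `α := 0`): only `1 ≤ L`, `η ≠ 0`, `a > 0` remain.
[cite: Balaban1985BackgroundPropagators, Thm 3.11 p.416, (3.26) p.395; Balaban1984PropagatorsI, (1.72) p.30] -/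
theorem laplaceAk_one_pos₀ (x : BondL2K ℂ d (towerP L m (n + 1)) c₀ W) (hx : x ≠ 0) :
    0 < RCLike.re ⟪x, laplaceAk L m n φ η (fun _ : Bond d (towerP L m (n + 1)) => (1 : 𝔸ˣ)) hL (fun _ => 0) (fun _ => by norm_num)
      (perCfg_UlevOf_one_mem_U1 L m (n + 1)) (norm_Wcx_UlevOf_one_sub_one_le L m (n + 1) (fun _ => 0) (fun _ => le_rfl)) τ
      (c₀ := c₀) (c₁ := c₁) a x⟫_ℂ :=
  laplaceAk_one_pos L m n hL φ (c₀ := c₀) (c₁ := c₁) hη _ _ _ _ τ ha x hx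

/-- **THE SHAPE OF [B9] THM 3.11's SECOND HALF AT `n+1` LEVELS**: a flat constant `γ₀ > 0` such that every operator `T` on the fine `L²` bond space
which is `δ`-close to the flat `(n+1)`-level operator (`‖(T − Δ_a(1))x‖ ≤ δ‖x‖`, `δ < γ₀`) — e.g. `Δ_a(U)` of a small field once the tower
Lipschitz moduli are supplied — is `(γ₀ − δ)`-coercive (`B5Eq172HodgePositivity.coercive_of_sub_le`); the closeness is DISPLAYED (print: the
regularity (3.35)–(3.37) via (3.86)). [cite: Balaban1985BackgroundPropagators, Thm 3.11 p.416, (3.86) p.407, (3.35)–(3.37) p.396] -/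
theorem exists_coercive_laplaceAk_of_near_flat (α : ℕ → ℝ) (hα1 : ∀ j, α j ≤ 1 / 64)
    (hU1 : ∀ (j : ℕ) (x : B7Prop1Explicit.Site d) (κ : Fin d),
      perCfg (towerP L m (j + 1)) (UlevOf L m (n + 1) (fun _ : Bond d (towerP L m (n + 1)) => (1 : 𝔸ˣ)) j) x κ ∈ U1 𝔸)
    (hreg : ∀ (j : ℕ) (y : TSite d (towerP L m j)) (κ : Fin d) (r : Fin d → Fin L),
      ‖((Wcx L (perCfg (towerP L m (j + 1)) (UlevOf L m (n + 1) (fun _ : Bond d (towerP L m (n + 1)) => (1 : 𝔸ˣ)) j)) (cornerSite L y) κ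
        (boxVec L r) : 𝔸ˣ) : 𝔸) - 1‖ ≤ α j) :
    ∃ γ₀ : ℝ, 0 < γ₀ ∧ ∀ (T : BondL2K ℂ d (towerP L m (n + 1)) c₀ W →ₗ[ℂ] BondL2K ℂ d (towerP L m (n + 1)) c₀ W) {δ : ℝ},
      (∀ x, ‖T x - laplaceAk L m n φ η (fun _ : Bond d (towerP L m (n + 1)) => (1 : 𝔸ˣ)) hL α hα1 hU1 hreg τ (c₀ := c₀) (c₁ := c₁) a x‖ ≤
        δ * ‖x‖) →
      ∀ x, (γ₀ - δ) * ‖x‖ ^ 2 ≤ RCLike.re ⟪x, T x⟫_ℂ := by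
  obtain ⟨γ₀, hγ₀, hflat⟩ := exists_coercive_laplaceAk_one L m n hL φ (c₀ := c₀) (c₁ := c₁) hη α hα1 hU1 hreg τ ha
  exact ⟨γ₀, hγ₀, fun T δ hT x => coercive_of_sub_le hflat hT x⟩

end Closed

end Literature.MathematicalPhysics.QuantumFieldTheory.Balaban1983to89.B9Eq326OperatorTowerFlat

end
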